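import Summits.QuantumFields.YangMills.Theorems.BalabanUVNodesN15BackgroundV1ExactCoefficients
import HarnessLib

/-!
# THE FIFTEEN COEFFICIENT LETTERS `TwoSidedLetters` FOR THE EXACT COEFFICIENTS `(v1coefCX, v1coefAX)` OF BAŁABAN's `V′₁(A)` (3.52) — FILE 25's twin with the backward `F′`-argument
# NEGATED as (3.50) demands — from the letters of the field triples and of one fine and one coarse gauge field
# (dag-n15-c g10, FILE 29b; Track-A node N15 = NE2, s1 «background-layer OPERATOR ingredient»)

`--kind proof --supports stmt-QuantumFields-20544 --as helper` (K3⁷; count-neutral; theorems only).  Imports BY NAME this seat's FILE 29a `…BackgroundV1ExactCoefficients` (the negated-letter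
mechanisms and the four coefficient letters; through it FILE 28 `v1coefCX` ∕ `v1coefAX` ∕ `v1coefAX_inl` ∕ `_inr`, FILE 25 `fgradMat_entry` ∕ `row_fgrad_ad_le` ∕ `row_fgrad_Phi2ad_le` ∕
`row_dfit_ad_le` ∕ `row_dfit_Phi2ad_le`, FILE 24 `TwoSidedLetters`, V1a∕V1b `rowFit_ad_le` ∕ `rowFit_Phi2ad_le` ∕ `v1fieldsOfGauge`, n15-b `coordMat` ∕ `basisConst`, [Lit] `adCLM`); nothing
in the tree is modified.

WHAT.  §2 ★★ `twoSidedLettersX_of_triples` — FILE 25 §2's statement and proof for the exact coefficients (`TwoSidedLetters J ι π s s′ η⁻¹ η′⁻¹ (14e(1+|J|)κ_e r) θ`; backward slots through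
the negated-letter mechanisms).  §3 ★★ `twoSidedLettersX_of_gauge` — FILE 25 §3 verbatim: the five gauge letters of one fine and one coarse gauge field suffice (scale `14e(1+|J|)²κ_e r`).

HONEST FRAMING.  Crude constants; `U ≡ 1` chart; `𝔤 ↦ 𝔄` with coordinates `e`; nothing about `G(U)` asserted here; NE2⁺ NOT PRINTED; count-neutral; N15 NOT discharged; one finite torus
at fixed ε — NOT ℝ⁴, NOT infinite volume, NOT OS, NOT a mass gap, NOT Clay.
-/

noncomputable section

open scoped BigOperators
open Finset

namespace Summit.QuantumFields.YangMills.BalabanUVNodes.N15.BackgroundLayer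

open Literature.MathematicalPhysics.QuantumFieldTheory.Balaban1983to89.Beta.AveragingCorrectionJets (adCLM adCLM_smul)
open Summit.QuantumFields.YangMills.BalabanUVNodes.N15.MatrixSpecies (Phi2 coordMat coordMat_sub basisConst basisConst_nonneg rowDiff_ad adCLM_sub rowBound_ad)

/-! ## §2 The fifteen letters from the letters of the field triples -/

section Triples

variable {X X' J ι : Type} [Fintype J] [Fintype ι] [DecidableEq ι] {𝔄 : Type} [NormedRing 𝔄] [NormedAlgebra ℝ 𝔄] [CompleteSpace 𝔄] (e : 𝔄 ≃L[ℝ] (ι → ℝ))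

/-- ★★ **THE FIFTEEN LETTERS OF THE TWO-SIDED BY-PARTS LAYER FOR THE COEFFICIENTS OF `V′₁(A)` FROM THE LETTERS OF THE FIELD TRIPLES.**  Fine triple `U′ = (P′, Q′, W′)` (spacing `η′`,
shifts `s′`), coarse triple `U = (P, Q, W)` (spacing `η`, shifts `s`), `0 < η′ ≤ η ≤ min(1, θ)`, sups `≤ r` (`2r ≤ 1`), fits `≤ rθ`, one-step letters `‖P_μ − P_μ∘s_μ⁻¹‖, ‖Q_μ − Q_μ∘s_μ⁻¹‖ ≤ rη`
(`rη′` for the fine triple), translated fits of `P_μ∘s_μ⁻¹` and `Q_μ∘s_μ`, derivative fits of the backward quotient of `P_μ` and the forward quotient of `Q_μ` (`≤ rθ`):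
`TwoSidedLetters J ι π s s′ η⁻¹ η′⁻¹ (14e(1+|J|)κ_e r) θ (c′, a′) (c, a)`.  Rows and fits by V1a; gradient rows, translated ∕ derivative fits and the coarse oscillation by §1.
[cite: Balaban1985BackgroundPropagators, (3.35)–(3.36) p.396, (3.52) p.400 (shapes)] -/
theorem twoSidedLettersX_of_triples {π : X' → X} {s : J → X ≃ X} {s' : J → X' ≃ X'} {η η' r θ : ℝ} (hη' : 0 < η') (hη'η : η' ≤ η) (hη1 : η ≤ 1) (hηθ : η ≤ θ)
    (hr : 0 ≤ r) (hr2 : 2 * r ≤ 1) {U' : (J → X' → 𝔄) × (J → X' → 𝔄) × (X' → 𝔄)} {U : (J → X → 𝔄) × (J → X → 𝔄) × (X → 𝔄)}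
    (hU'₁ : ∀ μ x', ‖U'.1 μ x'‖ ≤ r) (hU'₂ : ∀ μ x', ‖U'.2.1 μ x'‖ ≤ r) (hU'₃ : ∀ x', ‖U'.2.2 x'‖ ≤ r) (hU₁ : ∀ μ x, ‖U.1 μ x‖ ≤ r) (hU₂ : ∀ μ x, ‖U.2.1 μ x‖ ≤ r)
    (hU₃ : ∀ x, ‖U.2.2 x‖ ≤ r) (hf₁ : ∀ μ x', ‖U'.1 μ x' - U.1 μ (π x')‖ ≤ r * θ) (hf₂ : ∀ μ x', ‖U'.2.1 μ x' - U.2.1 μ (π x')‖ ≤ r * θ)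
    (hf₃ : ∀ x', ‖U'.2.2 x' - U.2.2 (π x')‖ ≤ r * θ)
    (hδ'₁ : ∀ μ x', ‖U'.1 μ x' - U'.1 μ ((s' μ).symm x')‖ ≤ r * η') (hδ'₂ : ∀ μ x', ‖U'.2.1 μ x' - U'.2.1 μ ((s' μ).symm x')‖ ≤ r * η')
    (hδ₁ : ∀ μ x, ‖U.1 μ x - U.1 μ ((s μ).symm x)‖ ≤ r * η) (hδ₂ : ∀ μ x, ‖U.2.1 μ x - U.2.1 μ ((s μ).symm x)‖ ≤ r * η)
    (hT₁ : ∀ μ x', ‖U'.1 μ ((s' μ).symm x') - U.1 μ ((s μ).symm (π x'))‖ ≤ r * θ) (hT₂ : ∀ μ x', ‖U'.2.1 μ (s' μ x') - U.2.1 μ (s μ (π x'))‖ ≤ r * θ)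
    (hD₁ : ∀ μ x', ‖η'⁻¹ • (U'.1 μ x' - U'.1 μ ((s' μ).symm x')) - η⁻¹ • (U.1 μ (π x') - U.1 μ ((s μ).symm (π x')))‖ ≤ r * θ)
    (hD₂ : ∀ μ x', ‖η'⁻¹ • (U'.2.1 μ (s' μ x') - U'.2.1 μ x') - η⁻¹ • (U.2.1 μ (s μ (π x')) - U.2.1 μ (π x'))‖ ≤ r * θ) :
    TwoSidedLetters J ι π s s' η⁻¹ η'⁻¹ (14 * Real.exp 1 * (1 + Fintype.card J) * basisConst e * r) θ (v1coefCX e η' U', v1coefAX e η' U')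
      (v1coefCX e η U, v1coefAX e η U) := by
  have hκ := basisConst_nonneg e
  have hE : (1 : ℝ) ≤ Real.exp 1 := by have := Real.add_one_le_exp (1 : ℝ); linarith
  have hJ : (0 : ℝ) ≤ Fintype.card J := Nat.cast_nonneg _
  have hη : 0 < η := lt_of_lt_of_le hη' hη'η
  have hη'1 : η' ≤ 1 := hη'η.trans hη1
  have hθ : 0 ≤ θ := hη.le.trans hηθ
  have hrθ : 0 ≤ r * θ := mul_nonneg hr hθ
  have ht : 0 ≤ Real.exp 1 * basisConst e * r := by positivity
  have htθ : 0 ≤ Real.exp 1 * basisConst e * (r * θ) := by positivity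
  -- the two closing inequalities: `C·(eκr) ≤ a` and `C·(eκ·rθ) ≤ aθ` for `C ≤ 14(1+|J|)`
  have hA : ∀ {v C : ℝ}, v ≤ C * (Real.exp 1 * basisConst e * r) → C ≤ 14 * (1 + Fintype.card J) → v ≤ 14 * Real.exp 1 * (1 + Fintype.card J) * basisConst e * r :=
    fun {v C} hv hC => hv.trans ((mul_le_mul_of_nonneg_right hC ht).trans (le_of_eq (by ring)))
  have hB : ∀ {v C : ℝ}, v ≤ C * (Real.exp 1 * basisConst e * (r * θ)) → C ≤ 14 * (1 + Fintype.card J) →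
      v ≤ 14 * Real.exp 1 * (1 + Fintype.card J) * basisConst e * r * θ :=
    fun {v C} hv hC => hv.trans ((mul_le_mul_of_nonneg_right hC htθ).trans (le_of_eq (by ring)))
  -- one-step letters in the forward form and at translated points
  have hδ₁f : ∀ μ x, ‖U.1 μ (s μ x) - U.1 μ x‖ ≤ r * η := fun μ x => by simpa only [Equiv.symm_apply_apply] using hδ₁ μ (s μ x)
  have hδ'₁f : ∀ μ x', ‖U'.1 μ (s' μ x') - U'.1 μ x'‖ ≤ r * η' := fun μ x' => by simpa only [Equiv.symm_apply_apply] using hδ'₁ μ (s' μ x')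
  -- translated triples (for the translated fits 11 ∕ 14)
  have hTr := rowFit_v1coefAX e π hr hr2 hη'.le hη'η hη1 hηθ (U' := (fun μ x' => U'.1 μ ((s' μ).symm x'), fun μ x' => U'.2.1 μ (s' μ x'), U'.2.2))
    (U := (fun μ x => U.1 μ ((s μ).symm x), fun μ x => U.2.1 μ (s μ x), U.2.2)) (fun μ x' => hU'₁ μ _) (fun μ x' => hU'₂ μ _) (fun μ x => hU₁ μ _) (fun μ x => hU₂ μ _)
    hT₁ hT₂
  refine ⟨?_, ?_, ?_, ?_, ?_, ?_, ?_, ?_, ?_, ?_, ?_, ?_, ?_, ?_, ?_⟩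
  -- 1–4: rows
  · exact fun x i => hA (C := 4 * (1 + Fintype.card J)) ((rowSum_v1coefCX_le e hr hr2 hη.le hη1 hU₁ hU₂ hU₃ x i).trans (le_of_eq (by ring))) (by nlinarith)
  · exact fun μ x i => hA (C := 4) ((rowSum_v1coefAX_le e hr hr2 hη.le hη1 hU₁ hU₂ μ x i).trans (le_of_eq (by ring))) (by nlinarith)
  · exact fun x' i => hA (C := 4 * (1 + Fintype.card J)) ((rowSum_v1coefCX_le e hr hr2 hη'.le hη'1 hU'₁ hU'₂ hU'₃ x' i).trans (le_of_eq (by ring))) (by nlinarith)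
  · exact fun μ x' i => hA (C := 4) ((rowSum_v1coefAX_le e hr hr2 hη'.le hη'1 hU'₁ hU'₂ μ x' i).trans (le_of_eq (by ring))) (by nlinarith)
  -- 5–6: fits
  · exact fun x' i => hB (C := 12 * (1 + Fintype.card J)) ((rowFit_v1coefCX e π hr hr2 hη'.le hη'η hη1 hηθ hU'₁ hU'₂ hU₁ hU₂ hf₁ hf₂ hf₃ x' i).trans (le_of_eq (by ring)))
      (by nlinarith)
  · exact fun μ x' i => hB (C := 10) ((rowFit_v1coefAX e π hr hr2 hη'.le hη'η hη1 hηθ hU'₁ hU'₂ hU₁ hU₂ hf₁ hf₂ μ x' i).trans (le_of_eq (by ring))) (by nlinarith)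
  -- 7–10: gradient rows (forward coarse ∕ fine, backward coarse ∕ fine)
  · intro μ x i
    have h1 := row_fgrad_ad_le e hη (s μ) (hδ₁ μ) x i
    have h2 := row_fgrad_Phi2ad_le e hη hη1 hr hr2 (s μ) (hU₁ μ) (hδ₁ μ) x i
    refine hA (C := 2 + 6) ?_ (by nlinarith)
    calc ∑ j, |fgradMat η⁻¹ (s μ) (v1coefAX e η U (Sum.inl μ)) x i j|
        ≤ ∑ j, (|η⁻¹ * (coordMat e (adCLM ℝ (U.1 μ (s μ x))) i j - coordMat e (adCLM ℝ (U.1 μ x)) i j)| +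
          |η⁻¹ * (η * coordMat e (Phi2 η (adCLM ℝ (U.1 μ (s μ x)))) i j - η * coordMat e (Phi2 η (adCLM ℝ (U.1 μ x))) i j)|) := Finset.sum_le_sum fun j _ => by
            rw [fgradMat_entry, v1coefAX_inl, v1coefAX_inl]
            simp only [Matrix.add_apply, Matrix.smul_apply, smul_eq_mul]
            rw [show ∀ p q u v : ℝ, η⁻¹ * ((p + q) - (u + v)) = η⁻¹ * (p - u) + η⁻¹ * (q - v) from fun p q u v => by ring]
            exact abs_add_le _ _
      _ ≤ basisConst e * (2 * r) + basisConst e * (6 * Real.exp 1 * (r * η)) := by rw [Finset.sum_add_distrib]; exact add_le_add h1 h2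
      _ ≤ (2 + 6) * (Real.exp 1 * basisConst e * r) := by nlinarith [mul_nonneg hκ hr, mul_le_mul_of_nonneg_left hη1 (mul_nonneg (mul_nonneg (zero_le_one.trans hE) hκ) hr)]
  · intro μ x' i
    have h1 := row_fgrad_ad_le e hη' (s' μ) (hδ'₁ μ) x' i
    have h2 := row_fgrad_Phi2ad_le e hη' hη'1 hr hr2 (s' μ) (hU'₁ μ) (hδ'₁ μ) x' i
    refine hA (C := 2 + 6) ?_ (by nlinarith)
    calc ∑ j, |fgradMat η'⁻¹ (s' μ) (v1coefAX e η' U' (Sum.inl μ)) x' i j|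
        ≤ ∑ j, (|η'⁻¹ * (coordMat e (adCLM ℝ (U'.1 μ (s' μ x'))) i j - coordMat e (adCLM ℝ (U'.1 μ x')) i j)| +
          |η'⁻¹ * (η' * coordMat e (Phi2 η' (adCLM ℝ (U'.1 μ (s' μ x')))) i j - η' * coordMat e (Phi2 η' (adCLM ℝ (U'.1 μ x'))) i j)|) := Finset.sum_le_sum fun j _ => by
            rw [fgradMat_entry, v1coefAX_inl, v1coefAX_inl]
            simp only [Matrix.add_apply, Matrix.smul_apply, smul_eq_mul]
            rw [show ∀ p q u v : ℝ, η'⁻¹ * ((p + q) - (u + v)) = η'⁻¹ * (p - u) + η'⁻¹ * (q - v) from fun p q u v => by ring]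
            exact abs_add_le _ _
      _ ≤ basisConst e * (2 * r) + basisConst e * (6 * Real.exp 1 * (r * η')) := by rw [Finset.sum_add_distrib]; exact add_le_add h1 h2
      _ ≤ (2 + 6) * (Real.exp 1 * basisConst e * r) := by nlinarith [mul_nonneg hκ hr, mul_le_mul_of_nonneg_left hη'1 (mul_nonneg (mul_nonneg (zero_le_one.trans hE) hκ) hr)]
  · intro μ x i
    have h1 := row_fgrad_ad_le e hη (s μ) (hδ₂ μ) x i
    have h2 := row_fgrad_Phi2negad_le e hη hη1 hr hr2 (s μ) (hU₂ μ) (hδ₂ μ) x i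
    refine hA (C := 2 + 6) ?_ (by nlinarith)
    calc ∑ j, |fgradMat η⁻¹ (s μ) (v1coefAX e η U (Sum.inr μ)) x i j|
        ≤ ∑ j, (|η⁻¹ * (coordMat e (adCLM ℝ (U.2.1 μ (s μ x))) i j - coordMat e (adCLM ℝ (U.2.1 μ x)) i j)| +
          |η⁻¹ * (η * coordMat e (Phi2 (-η) (adCLM ℝ (U.2.1 μ (s μ x)))) i j - η * coordMat e (Phi2 (-η) (adCLM ℝ (U.2.1 μ x))) i j)|) := Finset.sum_le_sum fun j _ => by
            rw [fgradMat_entry, v1coefAX_inr, v1coefAX_inr]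
            simp only [Matrix.sub_apply, Matrix.smul_apply, smul_eq_mul]
            rw [show ∀ p q u v : ℝ, η⁻¹ * ((p - q) - (u - v)) = η⁻¹ * (p - u) - η⁻¹ * (q - v) from fun p q u v => by ring]
            exact abs_sub _ _
      _ ≤ basisConst e * (2 * r) + basisConst e * (6 * Real.exp 1 * (r * η)) := by rw [Finset.sum_add_distrib]; exact add_le_add h1 h2
      _ ≤ (2 + 6) * (Real.exp 1 * basisConst e * r) := by nlinarith [mul_nonneg hκ hr, mul_le_mul_of_nonneg_left hη1 (mul_nonneg (mul_nonneg (zero_le_one.trans hE) hκ) hr)]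
  · intro μ x' i
    have h1 := row_fgrad_ad_le e hη' (s' μ) (hδ'₂ μ) x' i
    have h2 := row_fgrad_Phi2negad_le e hη' hη'1 hr hr2 (s' μ) (hU'₂ μ) (hδ'₂ μ) x' i
    refine hA (C := 2 + 6) ?_ (by nlinarith)
    calc ∑ j, |fgradMat η'⁻¹ (s' μ) (v1coefAX e η' U' (Sum.inr μ)) x' i j|
        ≤ ∑ j, (|η'⁻¹ * (coordMat e (adCLM ℝ (U'.2.1 μ (s' μ x'))) i j - coordMat e (adCLM ℝ (U'.2.1 μ x')) i j)| +
          |η'⁻¹ * (η' * coordMat e (Phi2 (-η') (adCLM ℝ (U'.2.1 μ (s' μ x')))) i j - η' * coordMat e (Phi2 (-η') (adCLM ℝ (U'.2.1 μ x'))) i j)|) := Finset.sum_le_sum fun j _ => by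
            rw [fgradMat_entry, v1coefAX_inr, v1coefAX_inr]
            simp only [Matrix.sub_apply, Matrix.smul_apply, smul_eq_mul]
            rw [show ∀ p q u v : ℝ, η'⁻¹ * ((p - q) - (u - v)) = η'⁻¹ * (p - u) - η'⁻¹ * (q - v) from fun p q u v => by ring]
            exact abs_sub _ _
      _ ≤ basisConst e * (2 * r) + basisConst e * (6 * Real.exp 1 * (r * η')) := by rw [Finset.sum_add_distrib]; exact add_le_add h1 h2
      _ ≤ (2 + 6) * (Real.exp 1 * basisConst e * r) := by nlinarith [mul_nonneg hκ hr, mul_le_mul_of_nonneg_left hη'1 (mul_nonneg (mul_nonneg (zero_le_one.trans hE) hκ) hr)]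
  -- 11: forward translated fit (V1a on the translated triples, forward component)
  · exact fun μ x' i => hB (C := 10) ((hTr (Sum.inl μ) x' i).trans (le_of_eq (by ring))) (by nlinarith)
  -- 12: translated forward derivative fit
  · intro μ x' i
    have hn' : η'⁻¹ * η' = 1 := inv_mul_cancel₀ hη'.ne'
    have hn : η⁻¹ * η = 1 := inv_mul_cancel₀ hη.ne'
    have h1 := row_dfit_ad_le e π (a' := U'.1 μ) (b' := fun x' => U'.1 μ ((s' μ).symm x')) (a := U.1 μ) (b := fun x => U.1 μ ((s μ).symm x)) (hD₁ μ) x' i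
    have h2 := row_dfit_Phi2ad_le e π hr hr2 hη'.le hη'η hη1 hηθ (a' := U'.1 μ) (b' := fun x' => U'.1 μ ((s' μ).symm x')) (a := U.1 μ)
      (b := fun x => U.1 μ ((s μ).symm x)) (hU'₁ μ) (fun x' => hU'₁ μ _) (hU₁ μ) (fun x => hU₁ μ _) (hf₁ μ) (hT₁ μ) x' i
    refine hB (C := 2 + 12) ?_ (by nlinarith)
    calc ∑ j, |fgradMat η'⁻¹ (s' μ) (v1coefAX e η' U' (Sum.inl μ)) ((s' μ).symm x') i j - fgradMat η⁻¹ (s μ) (v1coefAX e η U (Sum.inl μ)) ((s μ).symm (π x')) i j|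
        ≤ ∑ j, (|η'⁻¹ * (coordMat e (adCLM ℝ (U'.1 μ x')) i j - coordMat e (adCLM ℝ (U'.1 μ ((s' μ).symm x'))) i j) -
            η⁻¹ * (coordMat e (adCLM ℝ (U.1 μ (π x'))) i j - coordMat e (adCLM ℝ (U.1 μ ((s μ).symm (π x')))) i j)| +
          |(coordMat e (Phi2 η' (adCLM ℝ (U'.1 μ x'))) i j - coordMat e (Phi2 η' (adCLM ℝ (U'.1 μ ((s' μ).symm x')))) i j) -
            (coordMat e (Phi2 η (adCLM ℝ (U.1 μ (π x')))) i j - coordMat e (Phi2 η (adCLM ℝ (U.1 μ ((s μ).symm (π x'))))) i j)|) := Finset.sum_le_sum fun j _ => by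
            rw [fgradMat_entry, fgradMat_entry, v1coefAX_inl, v1coefAX_inl, v1coefAX_inl, v1coefAX_inl]
            simp only [Equiv.apply_symm_apply, Matrix.add_apply, Matrix.smul_apply, smul_eq_mul]
            rw [show ∀ m m' p₁ q₁ p₂ q₂ u₁ v₁ u₂ v₂ : ℝ, m' * ((p₁ + η' * q₁) - (p₂ + η' * q₂)) - m * ((u₁ + η * v₁) - (u₂ + η * v₂)) =
              (m' * (p₁ - p₂) - m * (u₁ - u₂)) + ((m' * η') * (q₁ - q₂) - (m * η) * (v₁ - v₂)) from fun _ _ _ _ _ _ _ _ _ _ => by ring, hn', hn, one_mul, one_mul]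
            exact abs_add_le _ _
      _ ≤ basisConst e * (2 * (r * θ)) + basisConst e * (12 * Real.exp 1 * (r * θ)) := by rw [Finset.sum_add_distrib]; exact add_le_add h1 h2
      _ ≤ (2 + 12) * (Real.exp 1 * basisConst e * (r * θ)) := by nlinarith [mul_nonneg hκ hrθ]
  -- 13: coarse one-step oscillation of the forward coefficients
  · intro μ x i
    have hfit : ∀ x, ‖U.1 μ x - U.1 μ ((s μ).symm x)‖ ≤ r * θ := fun x => (hδ₁ μ x).trans (mul_le_mul_of_nonneg_left hηθ hr)
    have h1 := rowFit_ad_le e (fun x => (s μ).symm x) (a' := U.1 μ) (a := U.1 μ) hfit x i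
    have h2 := rowFit_Phi2ad_le e (fun x => (s μ).symm x) hr hr2 hη.le le_rfl hη1 hηθ (a' := U.1 μ) (a := U.1 μ) (hU₁ μ) (hU₁ μ) hfit x i
    refine hB (C := 2 + 6) ?_ (by nlinarith)
    calc ∑ j, |v1coefAX e η U (Sum.inl μ) x i j - v1coefAX e η U (Sum.inl μ) ((s μ).symm x) i j|
        ≤ ∑ j, (|coordMat e (adCLM ℝ (U.1 μ x)) i j - coordMat e (adCLM ℝ (U.1 μ ((s μ).symm x))) i j| +
          η * |coordMat e (Phi2 η (adCLM ℝ (U.1 μ x))) i j - coordMat e (Phi2 η (adCLM ℝ (U.1 μ ((s μ).symm x)))) i j|) := Finset.sum_le_sum fun j _ => by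
            rw [v1coefAX_inl, v1coefAX_inl]
            simp only [Matrix.add_apply, Matrix.smul_apply, smul_eq_mul]
            rw [show ∀ p q u v : ℝ, (p + η * q) - (u + η * v) = (p - u) + η * (q - v) from fun p q u v => by ring]
            refine (abs_add_le _ _).trans (le_of_eq ?_)
            rw [abs_mul, abs_of_nonneg hη.le]
      _ ≤ basisConst e * (2 * (r * θ)) + η * (basisConst e * (6 * Real.exp 1 * (r * θ))) := by
          rw [Finset.sum_add_distrib, ← Finset.mul_sum]; exact add_le_add h1 (mul_le_mul_of_nonneg_left h2 hη.le)
      _ ≤ (2 + 6) * (Real.exp 1 * basisConst e * (r * θ)) := by nlinarith [mul_nonneg hκ hrθ, mul_le_mul_of_nonneg_left hη1 (mul_nonneg (mul_nonneg (zero_le_one.trans hE) hκ) hrθ)]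
  -- 14: backward translated fit (V1a on the translated triples, backward component)
  · exact fun μ x' i => hB (C := 10) ((hTr (Sum.inr μ) x' i).trans (le_of_eq (by ring))) (by nlinarith)
  -- 15: untranslated backward derivative fit
  · intro μ x' i
    have hn' : η'⁻¹ * η' = 1 := inv_mul_cancel₀ hη'.ne'
    have hn : η⁻¹ * η = 1 := inv_mul_cancel₀ hη.ne'
    have h1 := row_dfit_ad_le e π (a' := fun x' => U'.2.1 μ (s' μ x')) (b' := U'.2.1 μ) (a := fun x => U.2.1 μ (s μ x)) (b := U.2.1 μ) (hD₂ μ) x' i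
    have h2 := row_dfit_Phi2negad_le e π hr hr2 hη'.le hη'η hη1 hηθ (a' := fun x' => U'.2.1 μ (s' μ x')) (b' := U'.2.1 μ) (a := fun x => U.2.1 μ (s μ x)) (b := U.2.1 μ)
      (fun x' => hU'₂ μ _) (hU'₂ μ) (fun x => hU₂ μ _) (hU₂ μ) (hT₂ μ) (hf₂ μ) x' i
    refine hB (C := 2 + 12) ?_ (by nlinarith)
    calc ∑ j, |fgradMat η'⁻¹ (s' μ) (v1coefAX e η' U' (Sum.inr μ)) x' i j - fgradMat η⁻¹ (s μ) (v1coefAX e η U (Sum.inr μ)) (π x') i j|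
        ≤ ∑ j, (|η'⁻¹ * (coordMat e (adCLM ℝ (U'.2.1 μ (s' μ x'))) i j - coordMat e (adCLM ℝ (U'.2.1 μ x')) i j) -
            η⁻¹ * (coordMat e (adCLM ℝ (U.2.1 μ (s μ (π x')))) i j - coordMat e (adCLM ℝ (U.2.1 μ (π x'))) i j)| +
          |(coordMat e (Phi2 (-η') (adCLM ℝ (U'.2.1 μ (s' μ x')))) i j - coordMat e (Phi2 (-η') (adCLM ℝ (U'.2.1 μ x'))) i j) -
            (coordMat e (Phi2 (-η) (adCLM ℝ (U.2.1 μ (s μ (π x'))))) i j - coordMat e (Phi2 (-η) (adCLM ℝ (U.2.1 μ (π x')))) i j)|) := Finset.sum_le_sum fun j _ => by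
            rw [fgradMat_entry, fgradMat_entry, v1coefAX_inr, v1coefAX_inr, v1coefAX_inr, v1coefAX_inr]
            simp only [Matrix.sub_apply, Matrix.smul_apply, smul_eq_mul]
            rw [show ∀ m m' p₁ q₁ p₂ q₂ u₁ v₁ u₂ v₂ : ℝ, m' * ((p₁ - η' * q₁) - (p₂ - η' * q₂)) - m * ((u₁ - η * v₁) - (u₂ - η * v₂)) =
              (m' * (p₁ - p₂) - m * (u₁ - u₂)) - ((m' * η') * (q₁ - q₂) - (m * η) * (v₁ - v₂)) from fun _ _ _ _ _ _ _ _ _ _ => by ring, hn', hn, one_mul, one_mul]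
            exact abs_sub _ _
      _ ≤ basisConst e * (2 * (r * θ)) + basisConst e * (12 * Real.exp 1 * (r * θ)) := by rw [Finset.sum_add_distrib]; exact add_le_add h1 h2
      _ ≤ (2 + 12) * (Real.exp 1 * basisConst e * (r * θ)) := by nlinarith [mul_nonneg hκ hrθ]


end Triples

/-! ## §3 The fifteen letters for the gauge triples of one fine and one coarse gauge field -/

section Gauge

variable {X X' J ι : Type} [Fintype J] [Fintype ι] [DecidableEq ι] {𝔄 : Type} [NormedRing 𝔄] [NormedAlgebra ℝ 𝔄] [CompleteSpace 𝔄] (e : 𝔄 ≃L[ℝ] (ι → ℝ))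

/-- ★★ **THE FIFTEEN LETTERS OF THE TWO-SIDED BY-PARTS LAYER FOR BAŁABAN's SPECIES (3.52) OF ONE FINE AND ONE COARSE GAUGE FIELD.**  For `A′` (spacing `η′`, unit shifts `s′`) and `A`
(spacing `η`, unit shifts `s`; `0 < η′ ≤ η ≤ min(1, θ)`) with the five GAUGE LETTERS at `r` (`2(1+|J|)r ≤ 1`): sups `≤ r`; one-step letters along the own direction `‖A_μ − A_μ∘s_μ⁻¹‖ ≤ rη`
(`rη′`); fit `‖A′_μ − A_μ∘π‖ ≤ rθ`; translated fit `‖A′_μ∘s′_μ⁻¹ − A_μ∘s_μ⁻¹∘π‖ ≤ rθ`; derivative fit `‖η′⁻¹(A′_μ − A′_μ∘s′_μ⁻¹) − η⁻¹(A_μ − A_μ∘s_μ⁻¹)∘π‖ ≤ rθ` — the coefficient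
configurations `(c′, a′)`, `(c, a)` of the gauge triples `v1fieldsOfGauge s′ η′ A′ = (A′, A′∘s′⁻¹, ∇′*A′)`, `v1fieldsOfGauge s η A` (V1b) obey
`TwoSidedLetters J ι π s s′ η⁻¹ η′⁻¹ (14e(1+|J|)²κ_e r) θ`.  (§2 at `r̂ = (1+|J|)r`: the divergence `W = Σ_μ η⁻¹(A_μ − A_μ∘s_μ⁻¹)` has sup `≤ |J|r` and fit `≤ |J|rθ` by the one-step and
derivative letters; the backward components are the translates.) [cite: Balaban1985BackgroundPropagators, (3.35)–(3.36) p.396, (3.52) p.400 (shapes)] -/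
theorem twoSidedLettersX_of_gauge {π : X' → X} {s : J → X ≃ X} {s' : J → X' ≃ X'} {η η' r θ : ℝ} (hη' : 0 < η') (hη'η : η' ≤ η) (hη1 : η ≤ 1) (hηθ : η ≤ θ)
    (hr : 0 ≤ r) (hr2 : 2 * ((1 + Fintype.card J) * r) ≤ 1) {A' : J → X' → 𝔄} {A : J → X → 𝔄} (hs' : ∀ μ x', ‖A' μ x'‖ ≤ r) (hs : ∀ μ x, ‖A μ x‖ ≤ r)
    (hd' : ∀ μ x', ‖A' μ x' - A' μ ((s' μ).symm x')‖ ≤ r * η') (hd : ∀ μ x, ‖A μ x - A μ ((s μ).symm x)‖ ≤ r * η) (hf : ∀ μ x', ‖A' μ x' - A μ (π x')‖ ≤ r * θ)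
    (hfT : ∀ μ x', ‖A' μ ((s' μ).symm x') - A μ ((s μ).symm (π x'))‖ ≤ r * θ)
    (hfD : ∀ μ x', ‖η'⁻¹ • (A' μ x' - A' μ ((s' μ).symm x')) - η⁻¹ • (A μ (π x') - A μ ((s μ).symm (π x')))‖ ≤ r * θ) :
    TwoSidedLetters J ι π s s' η⁻¹ η'⁻¹ (14 * Real.exp 1 * (1 + Fintype.card J) * basisConst e * ((1 + Fintype.card J) * r)) θ
      (v1coefCX e η' (v1fieldsOfGauge 𝔄 J s' η' A'), v1coefAX e η' (v1fieldsOfGauge 𝔄 J s' η' A'))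
      (v1coefCX e η (v1fieldsOfGauge 𝔄 J s η A), v1coefAX e η (v1fieldsOfGauge 𝔄 J s η A)) := by
  set R : ℝ := (1 + Fintype.card J) * r with hR
  have hJ : (0 : ℝ) ≤ Fintype.card J := Nat.cast_nonneg _
  have hrR : r ≤ R := by rw [hR]; nlinarith
  have hJR : Fintype.card J * r ≤ R := by rw [hR]; nlinarith
  have hR0 : 0 ≤ R := hr.trans hrR
  have hη : 0 < η := lt_of_lt_of_le hη' hη'η
  have hθ : 0 ≤ θ := hη.le.trans hηθ
  have hRθ : r * θ ≤ R * θ := mul_le_mul_of_nonneg_right hrR hθ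
  -- the divergence: sup `≤ |J|r`, fit `≤ |J|rθ`
  have hW : ∀ {Y : Type} (t : J → Y ≃ Y) {ζ : ℝ} (hζ : 0 < ζ) {B : J → Y → 𝔄} (hB : ∀ μ y, ‖B μ y - B μ ((t μ).symm y)‖ ≤ r * ζ) (y : Y),
      ‖∑ μ, ζ⁻¹ • (B μ y - B μ ((t μ).symm y))‖ ≤ R := by
    intro Y t ζ hζ B hB y
    calc ‖∑ μ, ζ⁻¹ • (B μ y - B μ ((t μ).symm y))‖ ≤ ∑ μ, ‖ζ⁻¹ • (B μ y - B μ ((t μ).symm y))‖ := norm_sum_le _ _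
      _ ≤ ∑ _μ : J, r := Finset.sum_le_sum fun μ _ => by
          rw [norm_smul, Real.norm_eq_abs, abs_of_nonneg (inv_nonneg.mpr hζ.le)]
          calc ζ⁻¹ * ‖B μ y - B μ ((t μ).symm y)‖ ≤ ζ⁻¹ * (r * ζ) := mul_le_mul_of_nonneg_left (hB μ y) (inv_nonneg.mpr hζ.le)
            _ = r := by field_simp
      _ = Fintype.card J * r := by rw [Finset.sum_const, Finset.card_univ, nsmul_eq_mul]
      _ ≤ R := hJR
  have hWf : ∀ x', ‖(∑ μ, η'⁻¹ • (A' μ x' - A' μ ((s' μ).symm x'))) - ∑ μ, η⁻¹ • (A μ (π x') - A μ ((s μ).symm (π x')))‖ ≤ R * θ := fun x' => by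
    rw [← Finset.sum_sub_distrib]
    calc _ ≤ ∑ μ, ‖η'⁻¹ • (A' μ x' - A' μ ((s' μ).symm x')) - η⁻¹ • (A μ (π x') - A μ ((s μ).symm (π x')))‖ := norm_sum_le _ _
      _ ≤ ∑ _μ : J, r * θ := Finset.sum_le_sum fun μ _ => hfD μ x'
      _ = Fintype.card J * (r * θ) := by rw [Finset.sum_const, Finset.card_univ, nsmul_eq_mul]
      _ ≤ R * θ := by nlinarith [mul_le_mul_of_nonneg_right hJR hθ]
  exact twoSidedLettersX_of_triples e hη' hη'η hη1 hηθ hR0 hr2 (U' := v1fieldsOfGauge 𝔄 J s' η' A') (U := v1fieldsOfGauge 𝔄 J s η A)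
    (fun μ x' => (hs' μ x').trans hrR) (fun μ x' => (hs' μ _).trans hrR) (hW s' hη' hd') (fun μ x => (hs μ x).trans hrR) (fun μ x => (hs μ _).trans hrR) (hW s hη hd)
    (fun μ x' => (hf μ x').trans hRθ) (fun μ x' => (hfT μ x').trans hRθ) hWf (fun μ x' => (hd' μ x').trans (mul_le_mul_of_nonneg_right hrR hη'.le))
    (fun μ x' => (hd' μ _).trans (mul_le_mul_of_nonneg_right hrR hη'.le)) (fun μ x => (hd μ x).trans (mul_le_mul_of_nonneg_right hrR hη.le))
    (fun μ x => (hd μ _).trans (mul_le_mul_of_nonneg_right hrR hη.le)) (fun μ x' => (hfT μ x').trans hRθ)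
    (fun μ x' => by simpa only [v1fieldsOfGauge, Equiv.symm_apply_apply] using (hf μ x').trans hRθ) (fun μ x' => (hfD μ x').trans hRθ)
    (fun μ x' => by simpa only [v1fieldsOfGauge, Equiv.symm_apply_apply] using (hfD μ x').trans hRθ)

end Gauge

end Summit.QuantumFields.YangMills.BalabanUVNodes.N15.BackgroundLayer

end
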